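/-
Copyright (c) 2026 the pub-hodgecm-mathlib formalisation cell (harness21).  Prover seat hodgecm-mathlib-LH4-p10 (g8) (LEAD F0P6-plan (g15) BATCH #181 (6)): Track B «K2-LIT»,
hLiu418 = stmt-HodgeConjecture-24832, residue #3 (x-a) KIND-W — the OF-RECORD instantiation of (x-a-pres)(ii): ★ FILE 18's three clauses + the (KW-fac) reading ⇒ the
sum-presentation letter `hpresW` of ★ `K2LiuKindWArchContinuationBridge.hex_of_sumPresentation` (R90-C10-p03), so the `hex` tie binds with ZERO presentation letters.
THEOREMS ONLY.
-/
import Summits.HodgeConjecture.HodgeConjecture.Theorems.K2LiuKindWArchLetterIntegrable   -- ★ p863408: ★ FILE A's frame currency, `unipDeltaChar`, `unipDeltaArch`, `Carrier`, `evalAt`, `hermOfReal`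
import Summits.HodgeConjecture.HodgeConjecture.Theorems.K2LiuKindWArchLetterDefs         -- ★ p863152: `skewMatrices`-indexed `FinfT`, the `hex` vocabulary
import Literature.NumberTheory.K2Lit.SiegelStandardExtension                            -- ★ `IwasawaDatum.pPart` (the Iwasawa height `modDelta ∘ pPart` of ★ FILE 18's clauses)
import Summits.HodgeConjecture.HodgeConjecture.Theorems.K2LiuKindWArchContinuationBridge    -- ★ p863572 (R90-C10-p03): `hex_of_sumPresentation` (the `hex` bytes from `hpresW`)
import Summits.HodgeConjecture.HodgeConjecture.Theorems.K2LiuKindWArchLetterIntegrableBridge -- ★ p863520 (K2Liu-p11): brings ★ FILE 18 `exists_flat_tube_presentation` + ★ `K2LiuArchSWSpanningDefs` dictionary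
import HarnessLib

/-!
# Crux `HLiu418`, residue #3 (x-a) KIND-W — (x-a-pres)(ii) OF RECORD: `hpresW` from ★ FILE 18's flat tube presentation and the (KW-fac) reading

Cell `hodgecm-mathlib`, crux item hLiu418 = `stmt-HodgeConjecture-24832`; squad K2, LEAD F0P6-plan (g15) BATCH #181 (6) («LH4-p10: the sibling
`K2LiuKindWArchContinuationOfRecord.lean` = the OF-RECORD instantiation — ★ FILE 18's three clauses per `A_j` + `hreadArch` ⇒ `hpresW` discharged»), KW desk F0P2-p08 (g3).
Lane `--supports stmt-HodgeConjecture-24832 --as helper` (count-neutral).  THEOREMS ONLY (no `def`, no instance, no notation, no named-fact hypothesis, no `sorry`).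

THE POINT.  R90-C10-p03's `K2LiuKindWArchContinuationBridge.hex_of_sumPresentation` pays ★ p863152 `kindWArchLetter_eq_integral`'s `hex` from ONE existential letter
`hpresW` per `(j, S, h)`: weights, a frame reading `eb` of `conj ψ_S(ι_∞ ·)`, a translate `g`, finitely many flat place-products `Gs s r w` with compact pictures `Q r w`, a
holomorphic scalar `Cst`, the per-`(r, w)` twisted Whittaker letters at `Fr (h_∞·g) w`, and the reading `FinfT j S h s a = Cst s · Σ_r c_r ∏_w Gs s r w (Fr (a·g) w)`.  This file
DISCHARGES the presentation half of that letter from the currency of record: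
* `hflat` — ★ FILE 18 `K2LiuArchFlatTubePresentation.exists_flat_tube_presentation`'s conclusion VERBATIM for the arch factor `A j` of the Σ⊗ presentation (Iwasawa datum `𝒦`,
  conjugator `g`, archimedean type `t`, base point `s₀`): `∃ mr c Q F, hF ∧ hQ ∧ ∀ s a, H_𝒦(a)^{2(s−s₀)}·A j a = H_𝒦(g⁻¹)^{2(s−s₀)}·Σ_r c_r ∏_w (‖det j(·,i1)‖^{2(s₀−s)}·F r w)(Fr (a·g) w)`;
* `hread` — the (KW-fac) reading `FinfT j S h s a = H_𝒦(a)^{2(s−s₀)} · A j a` (binder order `S h s j a`, as in K2Liu-p11's (i) twin ★ `hintArch_of_conjugator`);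
and KEEPS BY VALUE the two letters that are not presentation data: the character's frame reading `heb` (per `(S, h)`) and the per-place twisted Whittaker letters `hW` — per
`(S, h, w)` and for EVERY compact picture `Q : Carrier` (★ p863390's head is stated for arbitrary `Q`), at `Fr (h_∞·g) w` on `{2∕2 < re}`.
* §1 **`hpresW_of_flatTubeLetters`** ⊢ `hpresW` VERBATIM (`k w := −t_w`, `Cst s := H_𝒦(g⁻¹)^{2(s−s₀)}` — entire since `H_𝒦 > 0`, ★ `modDelta_pos` — `Gs s r w := ‖det j(·,i1)‖^{2(s₀−s)}·F r w`).
* §2 **`hex_of_flatTubeLetters`** ⊢ ★ p863152 `kindWArchLetter_eq_integral`'s `hex` VERBATIM := ★ `K2LiuKindWArchContinuationBridge.hex_of_sumPresentation` ∘ §1.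
* §3 **`hex_of_conjugator`** — §2 with `hflat` DISCHARGED INSIDE by ★ FILE 18 under FILE 18's frame letters BY VALUE, the Iwasawa datum `𝒦`, the conjugator `g` with its
  letter `hg`, `ht`, and the (KW-fac) arch clauses `hAlaw hfin hAc` per `j` (★ `isArchSiegelDeltaSection_of_finPart_eq_one` dictionary, as ★ p863520 §3): `hex` from
  {`heb`, `hW`} and letters of record.  (The frame stays explicit: `heb` and `hW` are statements ABOUT `Fr`, `B C` and `g`.)
HONEST LABEL.  Count-neutral helper; the per-place letters (definite: ★ p863390 modulo its `hKpic`; indefinite: «Φ6b-ind») and `heb` remain named inputs of the junction: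
`HC_CM` is proved only modulo the 7 printed citations (2 remaining named inputs: hLiu418 = `stmt-HodgeConjecture-24832`, h413 = `stmt-HodgeConjecture-24833`) until rung 0 closes.

## References
* [Shimura1997] G. Shimura, *Euler Products and Eisenstein Series*, CBMS 93 (1997), §16.4, §18.4.
* [KudlaRallis1994] S. Kudla, S. Rallis, Ann. of Math. 140 (1994), §1–§2.
* [MoeglinWaldspurger1995] C. Mœglin, J.-L. Waldspurger, *Spectral decomposition and Eisenstein series* (1995), II.1.5, IV.1.9.
* [BorelJacquet1979] A. Borel, H. Jacquet, Proc. Symp. Pure Math. 33 (1979), §4.1.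
-/

set_option autoImplicit false
set_option linter.dupNamespace false -- the mandated namespace repeats `HodgeConjecture.HodgeConjecture`

noncomputable section

open Complex Matrix MeasureTheory MeasureTheory.Measure NumberField IsDedekindDomain
open scoped ComplexConjugate NNReal Classical
open Literature.NumberTheory.GaloisRepresentations
open Literature.NumberTheory.Automorphic Literature.NumberTheory.Automorphic.UnitaryGroup
open Literature.NumberTheory.GelbartRogawski1991 Literature.NumberTheory.GelbartRogawski1991.GRConstruction
open Literature.NumberTheory.K2Lit.SiegelDoubled
open Literature.NumberTheory.ModularForms.SiegelUpperHalfSpace (denom)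
open Summit.HodgeConjecture.HodgeConjecture.Cruxes.HLiu418.K2LiuArchInducedTubeDefs
open Summit.HodgeConjecture.HodgeConjecture.Cruxes.HLiu418.K2LiuU22CompactPictureDefs
open Summit.HodgeConjecture.HodgeConjecture.Cruxes.HLiu418.K2LiuSiegelUnipotentLocalDefs (unipDeltaArch)
open Summit.HodgeConjecture.HodgeConjecture.Cruxes.HLiu418.K2LiuSiegelUnipotentFourierDefs (skewMatrices unipDeltaChar)
open Summit.HodgeConjecture.HodgeConjecture.Cruxes.HLiu418.K2LiuSiegelEisensteinKindWLetters (kindWFinset)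
open Summit.HodgeConjecture.HodgeConjecture.Cruxes.HLiu418.K2LiuKindWArchLetterDefs (archWhittakerIntegral)
open Summit.HodgeConjecture.HodgeConjecture.Cruxes.HLiu418.K2LiuKindWArchContinuationBridge (hex_of_sumPresentation)
open Summit.HodgeConjecture.HodgeConjecture.Cruxes.HLiu418.K2LiuArchSWSpanningDefs (isArchSiegelDeltaSection_of_finPart_eq_one)
open Summit.HodgeConjecture.HodgeConjecture.Cruxes.HLiu418.K2LiuArchFlatTubePresentation (exists_flat_tube_presentation)
open Literature.NumberTheory.ModularForms.SiegelUpperHalfSpace (moeb)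

namespace Summit.HodgeConjecture.HodgeConjecture.Cruxes.HLiu418.K2LiuKindWArchContinuationOfRecord

variable (L : Type) [Field L] [NumberField L] [IsCMField L]
variable {N₀ M₀ : ℕ} (e : Fin N₀ × Fin M₀ ≃ Fin 2)
  (dV : Fin N₀ → L) (hdV : ∀ i, IsCMField.complexConj L (dV i) = dV i)
  (dW : Fin M₀ → L) (hdW : ∀ i, IsCMField.complexConj L (dW i) = dW i)
  (Fr : UnitaryGroup.arch (Fp L) L (IsCMField.complexConj L) (2 + 2) (hermD L e dV hdV dW hdW) →
    {w : InfinitePlace L // w.IsComplex} → Matrix (Fin 2 ⊕ Fin 2) (Fin 2 ⊕ Fin 2) ℂ)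

/-! ## §0 The height scalar -/

/-- the height scalar `H^{2(s−s₀)}` (`H > 0`) is entire in `s` (here: on `{0 < re}`). [folklore] -/
theorem differentiableOn_height_cpow {H : ℝ} (hH : 0 < H) (s₀ : ℂ) : DifferentiableOn ℂ (fun s : ℂ => ((H : ℝ) : ℂ) ^ (2 * (s - s₀))) {s : ℂ | 0 < s.re} :=
  fun s _ => (((differentiableAt_id.sub_const s₀).const_mul (2 : ℂ)).const_cpow (Or.inl (by exact_mod_cast hH.ne'))).differentiableWithinAt

/-! ## §1 `hpresW` from ★ FILE 18's clauses and the (KW-fac) reading -/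

/-- **THE SUM-PRESENTATION LETTER `hpresW` OF ★ `K2LiuKindWArchContinuationBridge.hex_of_sumPresentation`, OF RECORD.**  Inputs: the anti-diagonal blocks `B C` of the frame
(by value, as they appear in the letter); the archimedean type `t`, an Iwasawa datum `𝒦`, the arch conjugator `g`, the base point `s₀`; the arch factors `A j` of the Σ⊗ presentation
with, per `j`, ★ FILE 18's conclusion `hflat j` VERBATIM; the (KW-fac) factors `FinfT` with the reading `hread`; the character's frame reading `heb` per `(S, h)`; and the per-place
twisted Whittaker letters `hW` per `(S, h, w)` for EVERY compact picture `Q`, at `Fr (h_∞·g) w` on `{2∕2 < re}`.  THEN `hpresW` VERBATIM (per `(j, S, h)`, `det ↑S ≠ 0`), with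
`k w := −t_w`, `eb := eb S h`, `Cst s := H_𝒦(g⁻¹)^{2(s−s₀)}` (★ `modDelta_pos`, §0), `Gs s r w := ‖det j(·, i1)‖^{2(s₀−s)} · F r w`.
[cite: Shimura1997, §16.4, §18.4] [cite: KudlaRallis1994, §1–§2] [cite: MoeglinWaldspurger1995, IV.1.9] [cite: BorelJacquet1979, §4.1] -/
theorem hpresW_of_flatTubeLetters (B C : {w : InfinitePlace L // w.IsComplex} → Matrix (Fin 2) (Fin 2) ℂ)
    (t : InfinitePlace L → ℤ) (𝒦 : IwasawaDatum L e dV hdV dW hdW)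
    (g : UnitaryGroup.arch (Fp L) L (IsCMField.complexConj L) (2 + 2) (hermD L e dV hdV dW hdW)) (s₀ : ℂ)
    {m : ℕ} (A : Fin m → UnitaryGroup.arch (Fp L) L (IsCMField.complexConj L) (2 + 2) (hermD L e dV hdV dW hdW) → ℂ)
    (hflat : ∀ j : Fin m, ∃ (mr : ℕ) (c : Fin mr → ℂ) (Q : Fin mr → {w : InfinitePlace L // w.IsComplex} → Carrier)
      (F : Fin mr → {w : InfinitePlace L // w.IsComplex} → Matrix (Fin 2 ⊕ Fin 2) (Fin 2 ⊕ Fin 2) ℂ → ℂ),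
      (∀ s r w, IsArchSiegelSection (fun z : ℂ => (conj z / ((‖z‖ : ℝ) : ℂ)) ^ (-(t w.1))) s
        (fun x => (((‖(denom x (I • (1 : Matrix (Fin 2) (Fin 2) ℂ))).det‖ : ℝ) : ℂ) ^ (2 * (s₀ - s))) * F r w x)) ∧
      (∀ s r w (v : Matrix (Fin 2) (Fin 2) ℂ), vᴴ * v = 1 → ∀ hv : v.det ≠ 0,
        (fun x => (((‖(denom x (I • (1 : Matrix (Fin 2) (Fin 2) ℂ))).det‖ : ℝ) : ℂ) ^ (2 * (s₀ - s))) * F r w x)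
          ((2 : ℂ)⁻¹ • fromBlocks (1 + v) (-(I • (1 - v))) (I • (1 - v)) (1 + v) : Matrix (Fin 2 ⊕ Fin 2) (Fin 2 ⊕ Fin 2) ℂ) = evalAt v hv (Q r w)) ∧
      ∀ (s : ℂ) (a : UnitaryGroup.arch (Fp L) L (IsCMField.complexConj L) (2 + 2) (hermD L e dV hdV dW hdW)),
        (((modDelta L e dV hdV dW hdW (𝒦.pPart (UnitaryGroup.archToAdelic (Fp L) L (IsCMField.complexConj L) (2 + 2) (hermD L e dV hdV dW hdW) a)) : ℝ) : ℂ) ^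
            (2 * (s - s₀))) * A j a =
          (((modDelta L e dV hdV dW hdW (𝒦.pPart (UnitaryGroup.archToAdelic (Fp L) L (IsCMField.complexConj L) (2 + 2) (hermD L e dV hdV dW hdW) g⁻¹)) : ℝ) : ℂ) ^
            (2 * (s - s₀))) *
          ∑ r, c r * ∏ w, (((‖(denom (Fr (a * g) w) (I • (1 : Matrix (Fin 2) (Fin 2) ℂ))).det‖ : ℝ) : ℂ) ^ (2 * (s₀ - s))) * F r w (Fr (a * g) w))
    (FinfT : Fin m → skewMatrices ((IsCMField.complexConj L : L ≃ₐ[Fp L] L) : L →+* L) ((gramR L e dV hdV dW hdW).map (algebraMap (Fp L) L)) →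
      HA L e dV hdV dW hdW → ℂ → UnitaryGroup.arch (Fp L) L (IsCMField.complexConj L) (2 + 2) (hermD L e dV hdV dW hdW) → ℂ)
    (hread : ∀ (S : skewMatrices ((IsCMField.complexConj L : L ≃ₐ[Fp L] L) : L →+* L) ((gramR L e dV hdV dW hdW).map (algebraMap (Fp L) L)))
      (h : HA L e dV hdV dW hdW) (s : ℂ) (j : Fin m) (a : UnitaryGroup.arch (Fp L) L (IsCMField.complexConj L) (2 + 2) (hermD L e dV hdV dW hdW)),
      FinfT j S h s a =
        (((modDelta L e dV hdV dW hdW (𝒦.pPart (UnitaryGroup.archToAdelic (Fp L) L (IsCMField.complexConj L) (2 + 2) (hermD L e dV hdV dW hdW) a)) : ℝ) : ℂ) ^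
            (2 * (s - s₀))) * A j a)
    (eb : skewMatrices ((IsCMField.complexConj L : L ≃ₐ[Fp L] L) : L →+* L) ((gramR L e dV hdV dW hdW).map (algebraMap (Fp L) L)) → HA L e dV hdV dW hdW →
      {w : InfinitePlace L // w.IsComplex} → Matrix (Fin 2) (Fin 2) ℂ → ℂ)
    (heb : ∀ (S : skewMatrices ((IsCMField.complexConj L : L ≃ₐ[Fp L] L) : L →+* L) ((gramR L e dV hdV dW hdW).map (algebraMap (Fp L) L)))
      (h : HA L e dV hdV dW hdW) (u : ↥(unipDeltaArch L e dV hdV dW hdW)),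
      (conj (unipDeltaChar L e dV hdV dW hdW (S : Matrix (Fin 2) (Fin 2) L)
          (UnitaryGroup.archToAdelic (Fp L) L (IsCMField.complexConj L) (2 + 2) (hermD L e dV hdV dW hdW)
            (u : UnitaryGroup.arch (Fp L) L (IsCMField.complexConj L) (2 + 2) (hermD L e dV hdV dW hdW))) : ℂ)) =
        ∏ w, eb S h w (Matrix.toBlocks₁₂ (Fr (u : UnitaryGroup.arch (Fp L) L (IsCMField.complexConj L) (2 + 2) (hermD L e dV hdV dW hdW)) w)))
    (hW : ∀ (S : skewMatrices ((IsCMField.complexConj L : L ≃ₐ[Fp L] L) : L →+* L) ((gramR L e dV hdV dW hdW).map (algebraMap (Fp L) L)))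
      (h : HA L e dV hdV dW hdW) (w : {w : InfinitePlace L // w.IsComplex}) (Q : Carrier),
      ∃ Ew : ℂ → ℂ, DifferentiableOn ℂ Ew {s : ℂ | 0 < s.re} ∧ ∀ s : ℂ, ((2 : ℕ) : ℝ) / 2 < s.re →
        ∀ F : Matrix (Fin 2 ⊕ Fin 2) (Fin 2 ⊕ Fin 2) ℂ → ℂ, IsArchSiegelSection (fun z : ℂ => (conj z / ((‖z‖ : ℝ) : ℂ)) ^ (-(t w.1))) s F →
          (∀ (v : Matrix (Fin 2) (Fin 2) ℂ), vᴴ * v = 1 → ∀ hv : v.det ≠ 0,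
            F ((2 : ℂ)⁻¹ • fromBlocks (1 + v) (-(I • (1 - v))) (I • (1 - v)) (1 + v) : Matrix (Fin 2 ⊕ Fin 2) (Fin 2 ⊕ Fin 2) ℂ) = evalAt v hv Q) →
          ∫ x : Fin 2 → Fin 2 → ℝ, F ((fromBlocks 0 (B w) (C w) 0 : Matrix (Fin 2 ⊕ Fin 2) (Fin 2 ⊕ Fin 2) ℂ) * fromBlocks 1 (hermOfReal x) 0 1 *
              Fr (UnitaryGroup.archPart (Fp L) L (IsCMField.complexConj L) (2 + 2) (hermD L e dV hdV dW hdW) h * g) w) *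
            eb S h w (hermOfReal x) = Ew s) :
    ∀ (j : Fin m) (S : skewMatrices ((IsCMField.complexConj L : L ≃ₐ[Fp L] L) : L →+* L) ((gramR L e dV hdV dW hdW).map (algebraMap (Fp L) L)))
      (h : HA L e dV hdV dW hdW), (S : Matrix (Fin 2) (Fin 2) L).det ≠ 0 →
      ∃ (k : {w : InfinitePlace L // w.IsComplex} → ℤ) (eb : {w : InfinitePlace L // w.IsComplex} → Matrix (Fin 2) (Fin 2) ℂ → ℂ)
        (g : UnitaryGroup.arch (Fp L) L (IsCMField.complexConj L) (2 + 2) (hermD L e dV hdV dW hdW))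
        (mr : ℕ) (c : Fin mr → ℂ) (Q : Fin mr → {w : InfinitePlace L // w.IsComplex} → Carrier) (Cst : ℂ → ℂ)
        (Gs : ℂ → Fin mr → {w : InfinitePlace L // w.IsComplex} → Matrix (Fin 2 ⊕ Fin 2) (Fin 2 ⊕ Fin 2) ℂ → ℂ),
        (∀ u : ↥(unipDeltaArch L e dV hdV dW hdW),
          (conj (unipDeltaChar L e dV hdV dW hdW (S : Matrix (Fin 2) (Fin 2) L)
              (UnitaryGroup.archToAdelic (Fp L) L (IsCMField.complexConj L) (2 + 2) (hermD L e dV hdV dW hdW)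
                (u : UnitaryGroup.arch (Fp L) L (IsCMField.complexConj L) (2 + 2) (hermD L e dV hdV dW hdW))) : ℂ)) =
            ∏ w, eb w (Matrix.toBlocks₁₂ (Fr (u : UnitaryGroup.arch (Fp L) L (IsCMField.complexConj L) (2 + 2) (hermD L e dV hdV dW hdW)) w))) ∧
        (∀ r w, ∃ Ew : ℂ → ℂ, DifferentiableOn ℂ Ew {s : ℂ | 0 < s.re} ∧ ∀ s : ℂ, ((2 : ℕ) : ℝ) / 2 < s.re →
          ∀ F : Matrix (Fin 2 ⊕ Fin 2) (Fin 2 ⊕ Fin 2) ℂ → ℂ, IsArchSiegelSection (fun z : ℂ => (conj z / ((‖z‖ : ℝ) : ℂ)) ^ (k w)) s F →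
            (∀ (v : Matrix (Fin 2) (Fin 2) ℂ), vᴴ * v = 1 → ∀ hv : v.det ≠ 0,
              F ((2 : ℂ)⁻¹ • fromBlocks (1 + v) (-(I • (1 - v))) (I • (1 - v)) (1 + v) : Matrix (Fin 2 ⊕ Fin 2) (Fin 2 ⊕ Fin 2) ℂ) = evalAt v hv (Q r w)) →
            ∫ x : Fin 2 → Fin 2 → ℝ, F ((fromBlocks 0 (B w) (C w) 0 : Matrix (Fin 2 ⊕ Fin 2) (Fin 2 ⊕ Fin 2) ℂ) * fromBlocks 1 (hermOfReal x) 0 1 *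
                Fr (UnitaryGroup.archPart (Fp L) L (IsCMField.complexConj L) (2 + 2) (hermD L e dV hdV dW hdW) h * g) w) *
              eb w (hermOfReal x) = Ew s) ∧
        DifferentiableOn ℂ Cst {s : ℂ | 0 < s.re} ∧
        (∀ s : ℂ, ((2 : ℕ) : ℝ) / 2 < s.re → ∀ r w, IsArchSiegelSection (fun z : ℂ => (conj z / ((‖z‖ : ℝ) : ℂ)) ^ (k w)) s (Gs s r w)) ∧
        (∀ s : ℂ, ((2 : ℕ) : ℝ) / 2 < s.re → ∀ r w, ∀ (v : Matrix (Fin 2) (Fin 2) ℂ), vᴴ * v = 1 → ∀ hv : v.det ≠ 0,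
          (Gs s r w) ((2 : ℂ)⁻¹ • fromBlocks (1 + v) (-(I • (1 - v))) (I • (1 - v)) (1 + v) : Matrix (Fin 2 ⊕ Fin 2) (Fin 2 ⊕ Fin 2) ℂ) = evalAt v hv (Q r w)) ∧
        (∀ s : ℂ, ((2 : ℕ) : ℝ) / 2 < s.re → ∀ a : UnitaryGroup.arch (Fp L) L (IsCMField.complexConj L) (2 + 2) (hermD L e dV hdV dW hdW),
          FinfT j S h s a = Cst s * ∑ r, c r * ∏ w, Gs s r w (Fr (a * g) w)) := by
  intro j S h _
  obtain ⟨mr, c, Q, F, hF, hQ, hsum⟩ := hflat j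
  exact ⟨fun w => -(t w.1), eb S h, g, mr, c, Q,
    (fun s => (((modDelta L e dV hdV dW hdW (𝒦.pPart (UnitaryGroup.archToAdelic (Fp L) L (IsCMField.complexConj L) (2 + 2) (hermD L e dV hdV dW hdW) g⁻¹)) : ℝ) : ℂ) ^
      (2 * (s - s₀)))),
    (fun s r w x => (((‖(denom x (I • (1 : Matrix (Fin 2) (Fin 2) ℂ))).det‖ : ℝ) : ℂ) ^ (2 * (s₀ - s))) * F r w x),
    heb S h, (fun r w => hW S h w (Q r w)), differentiableOn_height_cpow (modDelta_pos L e dV hdV dW hdW _) s₀,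
    (fun s _ r w => hF s r w), (fun s _ r w => hQ s r w), fun s _ a => by rw [hread S h s j a, hsum s a]⟩

/-! ## §2–§3 The `hex` bytes: composition with ★ `hex_of_sumPresentation`, and ★ FILE 18 called inside -/

section Hex

variable (T Tinv : {w : InfinitePlace L // w.IsComplex} → Matrix (Fin 2 ⊕ Fin 2) (Fin 2 ⊕ Fin 2) ℂ)
  (hFr : ∀ a w, Fr a w = T w * Matrix.reindex (e₂ (n := 2)).symm (e₂ (n := 2)).symm
    (((UnitaryGroup.archAt (Fp L) L (IsCMField.complexConj L) (2 + 2) (hermD L e dV hdV dW hdW) w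
      (UnitaryGroup.complexConj_smul_infinitePlace L w.1) (IsCMField.complexConj_ne_one L) a :
        UnitaryGroup.archLocal L (2 + 2) (hermD L e dV hdV dW hdW) w) : GL (Fin (2 + 2)) ℂ) : Matrix (Fin (2 + 2)) (Fin (2 + 2)) ℂ) * Tinv w)
  (hT2 : ∀ w, Tinv w * T w = 1)
  (hTU : ∀ w (g : GL (Fin (2 + 2)) ℂ), g ∈ UnitaryGroup.archLocal L (2 + 2) (hermD L e dV hdV dW hdW) w →
    (T w * Matrix.reindex (e₂ (n := 2)).symm (e₂ (n := 2)).symm (g : Matrix _ _ ℂ) * Tinv w)ᴴ * Matrix.J (Fin 2) ℂ *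
      (T w * Matrix.reindex (e₂ (n := 2)).symm (e₂ (n := 2)).symm (g : Matrix _ _ ℂ) * Tinv w) = Matrix.J (Fin 2) ℂ)
  [MeasurableSpace ↥(unipDeltaArch L e dV hdV dW hdW)] [BorelSpace ↥(unipDeltaArch L e dV hdV dW hdW)]

include hFr hT2 hTU in
/-- **★ p863152's `hex` FROM ★ FILE 18's CLAUSES, THE (KW-fac) READING, `heb` AND `hW`.**  ★ `K2LiuKindWArchContinuationBridge.hex_of_sumPresentation` ∘ §1: the frame
letters of record `(T, Tinv, Fr, hFr, hT1, hT2, hTU, hTiv, hTN)` and `hBC` BY VALUE, the bad set `T₀`, Haar carriers `νinf`, and §1's inputs ⊢ `hex` VERBATIM at `n := 2`.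
[cite: Shimura1997, §16.4, §18.4] [cite: KudlaRallis1994, §1–§2] [cite: MoeglinWaldspurger1995, II.1.5, IV.1.9] -/
theorem hex_of_flatTubeLetters (hT1 : ∀ w, T w * Tinv w = 1)
    (hTiv : ∀ w (u : GL (Fin (2 + 2)) ℂ), u ∈ UnitaryGroup.archLocal L (2 + 2) (hermD L e dV hdV dW hdW) w →
      K2LiuSiegelUnipotentLocalDefs.IsUnipM (n := 2) (u : Matrix (Fin (2 + 2)) (Fin (2 + 2)) ℂ) →
        ∃ b : Matrix (Fin 2) (Fin 2) ℂ, bᴴ = b ∧ T w * Matrix.reindex (e₂ (n := 2)).symm (e₂ (n := 2)).symm (u : Matrix _ _ ℂ) * Tinv w = fromBlocks 1 b 0 1)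
    (hTN : ∀ w (b : Matrix (Fin 2) (Fin 2) ℂ), bᴴ = b → ∃ u : GL (Fin (2 + 2)) ℂ,
      u ∈ UnitaryGroup.archLocal L (2 + 2) (hermD L e dV hdV dW hdW) w ∧ K2LiuSiegelUnipotentLocalDefs.IsUnipM (n := 2) (u : Matrix (Fin (2 + 2)) (Fin (2 + 2)) ℂ) ∧
        T w * Matrix.reindex (e₂ (n := 2)).symm (e₂ (n := 2)).symm (u : Matrix _ _ ℂ) * Tinv w = fromBlocks 1 b 0 1)
    (B C : {w : InfinitePlace L // w.IsComplex} → Matrix (Fin 2) (Fin 2) ℂ) (hBC : ∀ w, T w * fromBlocks 1 0 0 (-1) * Tinv w = fromBlocks 0 (B w) (C w) 0)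
    (T₀ : Finset (HeightOneSpectrum (𝓞 (Fp L))))
    (νinf : Finset (HeightOneSpectrum (𝓞 (Fp L))) → Measure ↥(unipDeltaArch L e dV hdV dW hdW)) [∀ T' : Finset (HeightOneSpectrum (𝓞 (Fp L))), (νinf T').IsHaarMeasure]
    (t : InfinitePlace L → ℤ) (𝒦 : IwasawaDatum L e dV hdV dW hdW)
    (g : UnitaryGroup.arch (Fp L) L (IsCMField.complexConj L) (2 + 2) (hermD L e dV hdV dW hdW)) (s₀ : ℂ)
    {m : ℕ} (A : Fin m → UnitaryGroup.arch (Fp L) L (IsCMField.complexConj L) (2 + 2) (hermD L e dV hdV dW hdW) → ℂ)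
    (hflat : ∀ j : Fin m, ∃ (mr : ℕ) (c : Fin mr → ℂ) (Q : Fin mr → {w : InfinitePlace L // w.IsComplex} → Carrier)
      (F : Fin mr → {w : InfinitePlace L // w.IsComplex} → Matrix (Fin 2 ⊕ Fin 2) (Fin 2 ⊕ Fin 2) ℂ → ℂ),
      (∀ s r w, IsArchSiegelSection (fun z : ℂ => (conj z / ((‖z‖ : ℝ) : ℂ)) ^ (-(t w.1))) s
        (fun x => (((‖(denom x (I • (1 : Matrix (Fin 2) (Fin 2) ℂ))).det‖ : ℝ) : ℂ) ^ (2 * (s₀ - s))) * F r w x)) ∧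
      (∀ s r w (v : Matrix (Fin 2) (Fin 2) ℂ), vᴴ * v = 1 → ∀ hv : v.det ≠ 0,
        (fun x => (((‖(denom x (I • (1 : Matrix (Fin 2) (Fin 2) ℂ))).det‖ : ℝ) : ℂ) ^ (2 * (s₀ - s))) * F r w x)
          ((2 : ℂ)⁻¹ • fromBlocks (1 + v) (-(I • (1 - v))) (I • (1 - v)) (1 + v) : Matrix (Fin 2 ⊕ Fin 2) (Fin 2 ⊕ Fin 2) ℂ) = evalAt v hv (Q r w)) ∧
      ∀ (s : ℂ) (a : UnitaryGroup.arch (Fp L) L (IsCMField.complexConj L) (2 + 2) (hermD L e dV hdV dW hdW)),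
        (((modDelta L e dV hdV dW hdW (𝒦.pPart (UnitaryGroup.archToAdelic (Fp L) L (IsCMField.complexConj L) (2 + 2) (hermD L e dV hdV dW hdW) a)) : ℝ) : ℂ) ^
            (2 * (s - s₀))) * A j a =
          (((modDelta L e dV hdV dW hdW (𝒦.pPart (UnitaryGroup.archToAdelic (Fp L) L (IsCMField.complexConj L) (2 + 2) (hermD L e dV hdV dW hdW) g⁻¹)) : ℝ) : ℂ) ^
            (2 * (s - s₀))) *
          ∑ r, c r * ∏ w, (((‖(denom (Fr (a * g) w) (I • (1 : Matrix (Fin 2) (Fin 2) ℂ))).det‖ : ℝ) : ℂ) ^ (2 * (s₀ - s))) * F r w (Fr (a * g) w))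
    (FinfT : Fin m → skewMatrices ((IsCMField.complexConj L : L ≃ₐ[Fp L] L) : L →+* L) ((gramR L e dV hdV dW hdW).map (algebraMap (Fp L) L)) →
      HA L e dV hdV dW hdW → ℂ → UnitaryGroup.arch (Fp L) L (IsCMField.complexConj L) (2 + 2) (hermD L e dV hdV dW hdW) → ℂ)
    (hread : ∀ (S : skewMatrices ((IsCMField.complexConj L : L ≃ₐ[Fp L] L) : L →+* L) ((gramR L e dV hdV dW hdW).map (algebraMap (Fp L) L)))
      (h : HA L e dV hdV dW hdW) (s : ℂ) (j : Fin m) (a : UnitaryGroup.arch (Fp L) L (IsCMField.complexConj L) (2 + 2) (hermD L e dV hdV dW hdW)),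
      FinfT j S h s a =
        (((modDelta L e dV hdV dW hdW (𝒦.pPart (UnitaryGroup.archToAdelic (Fp L) L (IsCMField.complexConj L) (2 + 2) (hermD L e dV hdV dW hdW) a)) : ℝ) : ℂ) ^
            (2 * (s - s₀))) * A j a)
    (eb : skewMatrices ((IsCMField.complexConj L : L ≃ₐ[Fp L] L) : L →+* L) ((gramR L e dV hdV dW hdW).map (algebraMap (Fp L) L)) → HA L e dV hdV dW hdW →
      {w : InfinitePlace L // w.IsComplex} → Matrix (Fin 2) (Fin 2) ℂ → ℂ)
    (heb : ∀ (S : skewMatrices ((IsCMField.complexConj L : L ≃ₐ[Fp L] L) : L →+* L) ((gramR L e dV hdV dW hdW).map (algebraMap (Fp L) L)))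
      (h : HA L e dV hdV dW hdW) (u : ↥(unipDeltaArch L e dV hdV dW hdW)),
      (conj (unipDeltaChar L e dV hdV dW hdW (S : Matrix (Fin 2) (Fin 2) L)
          (UnitaryGroup.archToAdelic (Fp L) L (IsCMField.complexConj L) (2 + 2) (hermD L e dV hdV dW hdW)
            (u : UnitaryGroup.arch (Fp L) L (IsCMField.complexConj L) (2 + 2) (hermD L e dV hdV dW hdW))) : ℂ)) =
        ∏ w, eb S h w (Matrix.toBlocks₁₂ (Fr (u : UnitaryGroup.arch (Fp L) L (IsCMField.complexConj L) (2 + 2) (hermD L e dV hdV dW hdW)) w)))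
    (hW : ∀ (S : skewMatrices ((IsCMField.complexConj L : L ≃ₐ[Fp L] L) : L →+* L) ((gramR L e dV hdV dW hdW).map (algebraMap (Fp L) L)))
      (h : HA L e dV hdV dW hdW) (w : {w : InfinitePlace L // w.IsComplex}) (Q : Carrier),
      ∃ Ew : ℂ → ℂ, DifferentiableOn ℂ Ew {s : ℂ | 0 < s.re} ∧ ∀ s : ℂ, ((2 : ℕ) : ℝ) / 2 < s.re →
        ∀ F : Matrix (Fin 2 ⊕ Fin 2) (Fin 2 ⊕ Fin 2) ℂ → ℂ, IsArchSiegelSection (fun z : ℂ => (conj z / ((‖z‖ : ℝ) : ℂ)) ^ (-(t w.1))) s F →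
          (∀ (v : Matrix (Fin 2) (Fin 2) ℂ), vᴴ * v = 1 → ∀ hv : v.det ≠ 0,
            F ((2 : ℂ)⁻¹ • fromBlocks (1 + v) (-(I • (1 - v))) (I • (1 - v)) (1 + v) : Matrix (Fin 2 ⊕ Fin 2) (Fin 2 ⊕ Fin 2) ℂ) = evalAt v hv Q) →
          ∫ x : Fin 2 → Fin 2 → ℝ, F ((fromBlocks 0 (B w) (C w) 0 : Matrix (Fin 2 ⊕ Fin 2) (Fin 2 ⊕ Fin 2) ℂ) * fromBlocks 1 (hermOfReal x) 0 1 *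
              Fr (UnitaryGroup.archPart (Fp L) L (IsCMField.complexConj L) (2 + 2) (hermD L e dV hdV dW hdW) h * g) w) *
            eb S h w (hermOfReal x) = Ew s) :
    ∀ (j : Fin m) (S : skewMatrices ((IsCMField.complexConj L : L ≃ₐ[Fp L] L) : L →+* L) ((gramR L e dV hdV dW hdW).map (algebraMap (Fp L) L)))
      (h : HA L e dV hdV dW hdW), (S : Matrix (Fin 2) (Fin 2) L).det ≠ 0 →
      ∃ F : ℂ → ℂ, DifferentiableOn ℂ F {s : ℂ | 0 < s.re} ∧ ∀ s : ℂ, ((2 : ℕ) : ℝ) / 2 < s.re → F s =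
        archWhittakerIntegral L e dV hdV dW hdW (νinf (kindWFinset L e dV hdV dW hdW T₀ (S : Matrix (Fin 2) (Fin 2) L) h)) (S : Matrix (Fin 2) (Fin 2) L)
          (FinfT j S h) (UnitaryGroup.archPart (Fp L) L (IsCMField.complexConj L) (2 + 2) (hermD L e dV hdV dW hdW) h) s :=
  hex_of_sumPresentation L e dV hdV dW hdW T Tinv Fr hFr hT2 hTU hT1 hTiv hTN B C hBC T₀ νinf FinfT
    (hpresW_of_flatTubeLetters L e dV hdV dW hdW Fr B C t 𝒦 g s₀ A hflat FinfT hread eb heb hW)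

include hFr hT2 hTU in
/-- **★ p863152's `hex` MODULO THE CONJUGATOR — ★ FILE 18 CALLED INSIDE.**  §2 with `hflat` discharged by ★ `K2LiuArchFlatTubePresentation.exists_flat_tube_presentation` per `j`:
inputs are FILE 18's frame letters BY VALUE (`hT1 … hTU`, the Siegel∕surjectivity letters `hTS hTV`, the Shimura shape `Dsh Csh hTsh hD hC`, the reading frames `fr hfrc hfrτ`,
`dV dW ≠ 0`), the unipotent letters `hTiv hTN` and `hBC` of ★ FILE A, an Iwasawa datum `𝒦`, a conjugator `g` with its letter `hg` (★ FILE 21's currency), the archimedean type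
`ht`, `s₀`, the (KW-fac) arch factors `A j` with their three output clauses VERBATIM (`hAlaw hfin hAc`, read through ★ `isArchSiegelDeltaSection_of_finPart_eq_one` as in
★ p863520 §3), the bad set, the Haar carriers, `FinfT` with `hread`, and the two analytic letters `heb`, `hW` ⊢ `hex` VERBATIM.
[cite: Shimura1997, §16.4, §18.4] [cite: KudlaRallis1994, §1–§2] [cite: Tan1999, §1, §3] [cite: BorelJacquet1979, §4.1] -/
theorem hex_of_conjugator (hdV0 : ∀ i, dV i ≠ 0) (hdW0 : ∀ i, dW i ≠ 0) (hT1 : ∀ w, T w * Tinv w = 1)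
    (hTiv : ∀ w (u : GL (Fin (2 + 2)) ℂ), u ∈ UnitaryGroup.archLocal L (2 + 2) (hermD L e dV hdV dW hdW) w →
      K2LiuSiegelUnipotentLocalDefs.IsUnipM (n := 2) (u : Matrix (Fin (2 + 2)) (Fin (2 + 2)) ℂ) →
        ∃ b : Matrix (Fin 2) (Fin 2) ℂ, bᴴ = b ∧ T w * Matrix.reindex (e₂ (n := 2)).symm (e₂ (n := 2)).symm (u : Matrix _ _ ℂ) * Tinv w = fromBlocks 1 b 0 1)
    (hTN : ∀ w (b : Matrix (Fin 2) (Fin 2) ℂ), bᴴ = b → ∃ u : GL (Fin (2 + 2)) ℂ,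
      u ∈ UnitaryGroup.archLocal L (2 + 2) (hermD L e dV hdV dW hdW) w ∧ K2LiuSiegelUnipotentLocalDefs.IsUnipM (n := 2) (u : Matrix (Fin (2 + 2)) (Fin (2 + 2)) ℂ) ∧
        T w * Matrix.reindex (e₂ (n := 2)).symm (e₂ (n := 2)).symm (u : Matrix _ _ ℂ) * Tinv w = fromBlocks 1 b 0 1)
    (hTS : ∀ w (g : GL (Fin (2 + 2)) ℂ), IsSiegelM (n := 2) (g : Matrix (Fin (2 + 2)) (Fin (2 + 2)) ℂ) →
      (T w * Matrix.reindex (e₂ (n := 2)).symm (e₂ (n := 2)).symm (g : Matrix _ _ ℂ) * Tinv w).toBlocks₂₁ = 0)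
    (hTV : ∀ w (P : Matrix (Fin 2 ⊕ Fin 2) (Fin 2 ⊕ Fin 2) ℂ), Pᴴ * Matrix.J (Fin 2) ℂ * P = Matrix.J (Fin 2) ℂ →
      ∃ g : GL (Fin (2 + 2)) ℂ, g ∈ UnitaryGroup.archLocal L (2 + 2) (hermD L e dV hdV dW hdW) w ∧
        T w * Matrix.reindex (e₂ (n := 2)).symm (e₂ (n := 2)).symm (g : Matrix _ _ ℂ) * Tinv w = P)
    (Dsh Csh : {w : InfinitePlace L // w.IsComplex} → Matrix (Fin 2) (Fin 2) ℂ)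
    (hTsh : ∀ w, T w = fromBlocks (Dsh w) (Dsh w) (Csh w) (-(Csh w))) (hD : ∀ w, IsUnit (Dsh w).det) (hC : ∀ w, IsUnit (Csh w).det)
    (fr : ∀ w : {w : InfinitePlace L // w.IsComplex}, Matrix.unitaryGroup (Fin 2) ℂ →* UnitaryGroup.archLocal L (2 + 2) (hermD L e dV hdV dW hdW) w)
    (hfrc : ∀ w, Continuous (fr w))
    (hfrτ : ∀ w (u : Matrix.unitaryGroup (Fin 2) ℂ),
      T w * Matrix.reindex (e₂ (n := 2)).symm (e₂ (n := 2)).symm (((fr w u : UnitaryGroup.archLocal L (2 + 2) (hermD L e dV hdV dW hdW) w) : GL (Fin (2 + 2)) ℂ) :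
        Matrix (Fin (2 + 2)) (Fin (2 + 2)) ℂ) * Tinv w =
      (2 : ℂ)⁻¹ • fromBlocks (1 + (u : Matrix (Fin 2) (Fin 2) ℂ)) (-(I • (1 - (u : Matrix (Fin 2) (Fin 2) ℂ)))) (I • (1 - (u : Matrix (Fin 2) (Fin 2) ℂ))) (1 + (u : Matrix (Fin 2) (Fin 2) ℂ)))
    (B C : {w : InfinitePlace L // w.IsComplex} → Matrix (Fin 2) (Fin 2) ℂ) (hBC : ∀ w, T w * fromBlocks 1 0 0 (-1) * Tinv w = fromBlocks 0 (B w) (C w) 0)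
    (T₀ : Finset (HeightOneSpectrum (𝓞 (Fp L))))
    (νinf : Finset (HeightOneSpectrum (𝓞 (Fp L))) → Measure ↥(unipDeltaArch L e dV hdV dW hdW)) [∀ T' : Finset (HeightOneSpectrum (𝓞 (Fp L))), (νinf T').IsHaarMeasure]
    (𝒦 : IwasawaDatum L e dV hdV dW hdW)
    (g : UnitaryGroup.arch (Fp L) L (IsCMField.complexConj L) (2 + 2) (hermD L e dV hdV dW hdW))
    (hg : ∀ k : UnitaryGroup.arch (Fp L) L (IsCMField.complexConj L) (2 + 2) (hermD L e dV hdV dW hdW),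
      (∀ w, moeb (Fr k w) (I • (1 : Matrix (Fin 2) (Fin 2) ℂ)) = I • 1) →
        (UnitaryGroup.archToAdelic (Fp L) L (IsCMField.complexConj L) (2 + 2) (hermD L e dV hdV dW hdW) (g * k * g⁻¹) : HA L e dV hdV dW hdW) ∈ 𝒦.K)
    {χ : HeckeCharacter L} {t : InfinitePlace L → ℤ} (ht : χ.HasUnitaryArchType t 0) (s₀ : ℂ)
    {m : ℕ} (A : Fin m → UnitaryGroup.arch (Fp L) L (IsCMField.complexConj L) (2 + 2) (hermD L e dV hdV dW hdW) → ℂ)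
    (hAlaw : ∀ j, ∀ p : HA L e dV hdV dW hdW, IsSiegelDelta L e dV hdV dW hdW p → UnitaryGroup.finPart (Fp L) L (IsCMField.complexConj L) (2 + 2) (hermD L e dV hdV dW hdW) p = 1 →
      ∀ x : UnitaryGroup.arch (Fp L) L (IsCMField.complexConj L) (2 + 2) (hermD L e dV hdV dW hdW),
        A j (UnitaryGroup.archPart (Fp L) L (IsCMField.complexConj L) (2 + 2) (hermD L e dV hdV dW hdW) p * x) = siegelDeltaCharacter L e dV hdV dW hdW χ s₀ p * A j x)
    (hfin : ∀ j, ∃ V : Submodule ℂ (UnitaryGroup.arch (Fp L) L (IsCMField.complexConj L) (2 + 2) (hermD L e dV hdV dW hdW) → ℂ), FiniteDimensional ℂ V ∧ A j ∈ V ∧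
      ∀ a₀ : UnitaryGroup.arch (Fp L) L (IsCMField.complexConj L) (2 + 2) (hermD L e dV hdV dW hdW),
        (UnitaryGroup.archToAdelic (Fp L) L (IsCMField.complexConj L) (2 + 2) (hermD L e dV hdV dW hdW) a₀ : HA L e dV hdV dW hdW) ∈ 𝒦.K → ∀ G ∈ V, (fun x => G (x * a₀)) ∈ V)
    (hAc : ∀ j, Continuous (A j))
    (FinfT : Fin m → skewMatrices ((IsCMField.complexConj L : L ≃ₐ[Fp L] L) : L →+* L) ((gramR L e dV hdV dW hdW).map (algebraMap (Fp L) L)) →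
      HA L e dV hdV dW hdW → ℂ → UnitaryGroup.arch (Fp L) L (IsCMField.complexConj L) (2 + 2) (hermD L e dV hdV dW hdW) → ℂ)
    (hread : ∀ (S : skewMatrices ((IsCMField.complexConj L : L ≃ₐ[Fp L] L) : L →+* L) ((gramR L e dV hdV dW hdW).map (algebraMap (Fp L) L)))
      (h : HA L e dV hdV dW hdW) (s : ℂ) (j : Fin m) (a : UnitaryGroup.arch (Fp L) L (IsCMField.complexConj L) (2 + 2) (hermD L e dV hdV dW hdW)),
      FinfT j S h s a =
        (((modDelta L e dV hdV dW hdW (𝒦.pPart (UnitaryGroup.archToAdelic (Fp L) L (IsCMField.complexConj L) (2 + 2) (hermD L e dV hdV dW hdW) a)) : ℝ) : ℂ) ^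
            (2 * (s - s₀))) * A j a)
    (eb : skewMatrices ((IsCMField.complexConj L : L ≃ₐ[Fp L] L) : L →+* L) ((gramR L e dV hdV dW hdW).map (algebraMap (Fp L) L)) → HA L e dV hdV dW hdW →
      {w : InfinitePlace L // w.IsComplex} → Matrix (Fin 2) (Fin 2) ℂ → ℂ)
    (heb : ∀ (S : skewMatrices ((IsCMField.complexConj L : L ≃ₐ[Fp L] L) : L →+* L) ((gramR L e dV hdV dW hdW).map (algebraMap (Fp L) L)))
      (h : HA L e dV hdV dW hdW) (u : ↥(unipDeltaArch L e dV hdV dW hdW)),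
      (conj (unipDeltaChar L e dV hdV dW hdW (S : Matrix (Fin 2) (Fin 2) L)
          (UnitaryGroup.archToAdelic (Fp L) L (IsCMField.complexConj L) (2 + 2) (hermD L e dV hdV dW hdW)
            (u : UnitaryGroup.arch (Fp L) L (IsCMField.complexConj L) (2 + 2) (hermD L e dV hdV dW hdW))) : ℂ)) =
        ∏ w, eb S h w (Matrix.toBlocks₁₂ (Fr (u : UnitaryGroup.arch (Fp L) L (IsCMField.complexConj L) (2 + 2) (hermD L e dV hdV dW hdW)) w)))
    (hW : ∀ (S : skewMatrices ((IsCMField.complexConj L : L ≃ₐ[Fp L] L) : L →+* L) ((gramR L e dV hdV dW hdW).map (algebraMap (Fp L) L)))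
      (h : HA L e dV hdV dW hdW) (w : {w : InfinitePlace L // w.IsComplex}) (Q : Carrier),
      ∃ Ew : ℂ → ℂ, DifferentiableOn ℂ Ew {s : ℂ | 0 < s.re} ∧ ∀ s : ℂ, ((2 : ℕ) : ℝ) / 2 < s.re →
        ∀ F : Matrix (Fin 2 ⊕ Fin 2) (Fin 2 ⊕ Fin 2) ℂ → ℂ, IsArchSiegelSection (fun z : ℂ => (conj z / ((‖z‖ : ℝ) : ℂ)) ^ (-(t w.1))) s F →
          (∀ (v : Matrix (Fin 2) (Fin 2) ℂ), vᴴ * v = 1 → ∀ hv : v.det ≠ 0,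
            F ((2 : ℂ)⁻¹ • fromBlocks (1 + v) (-(I • (1 - v))) (I • (1 - v)) (1 + v) : Matrix (Fin 2 ⊕ Fin 2) (Fin 2 ⊕ Fin 2) ℂ) = evalAt v hv Q) →
          ∫ x : Fin 2 → Fin 2 → ℝ, F ((fromBlocks 0 (B w) (C w) 0 : Matrix (Fin 2 ⊕ Fin 2) (Fin 2 ⊕ Fin 2) ℂ) * fromBlocks 1 (hermOfReal x) 0 1 *
              Fr (UnitaryGroup.archPart (Fp L) L (IsCMField.complexConj L) (2 + 2) (hermD L e dV hdV dW hdW) h * g) w) *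
            eb S h w (hermOfReal x) = Ew s) :
    ∀ (j : Fin m) (S : skewMatrices ((IsCMField.complexConj L : L ≃ₐ[Fp L] L) : L →+* L) ((gramR L e dV hdV dW hdW).map (algebraMap (Fp L) L)))
      (h : HA L e dV hdV dW hdW), (S : Matrix (Fin 2) (Fin 2) L).det ≠ 0 →
      ∃ F : ℂ → ℂ, DifferentiableOn ℂ F {s : ℂ | 0 < s.re} ∧ ∀ s : ℂ, ((2 : ℕ) : ℝ) / 2 < s.re → F s =
        archWhittakerIntegral L e dV hdV dW hdW (νinf (kindWFinset L e dV hdV dW hdW T₀ (S : Matrix (Fin 2) (Fin 2) L) h)) (S : Matrix (Fin 2) (Fin 2) L)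
          (FinfT j S h) (UnitaryGroup.archPart (Fp L) L (IsCMField.complexConj L) (2 + 2) (hermD L e dV hdV dW hdW) h) s :=
  hex_of_flatTubeLetters L e dV hdV dW hdW Fr T Tinv hFr hT2 hTU hT1 hTiv hTN B C hBC T₀ νinf t 𝒦 g s₀ A
    (fun j => exists_flat_tube_presentation L e dV hdV hdV0 dW hdW hdW0 T Tinv Fr hFr hT1 hT2 hTU hTS hTV Dsh Csh hTsh hD hC fr hfrc hfrτ 𝒦 g hg ht s₀
      (isArchSiegelDeltaSection_of_finPart_eq_one L e dV hdV dW hdW (hAlaw j)) (hfin j) (hAc j))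
    FinfT hread eb heb hW

end Hex

end Summit.HodgeConjecture.HodgeConjecture.Cruxes.HLiu418.K2LiuKindWArchContinuationOfRecord

end
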